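import Summits.MatrixMultiplication.MatrixMultiplication.Theorems.AbelianSTPPCensusTAStatKMemberX

/-!
# Static t*-certificate: soundness of the k-member tree with several Grynkiewicz parameters per node

Cell mm-stpp (rung F-M1); checkers in `AbelianSTPPCensusTAStatKMemberX.lean`.  The row facts are those of the single-parameter tree (`TAStatKM.Hyps` of
`AbelianSTPPCensusTAStatKMemberSound.lean` — note that its Grynkiewicz budget `bud` already holds at EVERY parameter `t ≥ 3` with a source member) plus the
EXTRA row facts `TAStatKM.XHyps`: every member other than `l` with `t ≤ TB[j+1] − 1`, `j ≤ jtop`, is dominated at every extra entry `(t′, gW′, wW′) ∈ xrow j`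
(genuine weight `V < t′·p` and U11-G fraction `g·wW′ ≤ gW′·(t′·p − V)`), denominators positive.  Then `rootKX … = true` at the bucket of `t*` gives
`Σ_q gain_q ≤ 10⁶·M` (`rootKX_sound`).  The proof is the gen-5 induction over the fuel with the explicit index set `S ∋ l` (`TAStatKM.NodeInv`, reused verbatim;
the source of an extra parameter is an explicit companion — `amin < t′ ≤ TB[j] ≤` its least pair product — or `l`), with the node closed either by `node_close`
(the bucket parameter) or by `testX_sound` (an extra parameter).  Exact integer twin: seat calc/twomember/tastat8.py (vp-p2 g6).
WHAT THIS IS NOT: no statement about STPP families, orders or `ω` — the arithmetic meaning of a Bool tree over shape data.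
-/

set_option linter.dupNamespace false
set_option autoImplicit false

namespace Summit.MatrixMultiplication.MatrixMultiplication.Theorems.TAStatKM

open TECert (vol us)
open TAStat (Entry e0)
open ShapeCert (D)

section Sound

variable {N : ℕ} (l : Fin N) (gq pq Vq mn tq : Fin N → ℕ) (ysh : Fin N → ℕ × ℕ × ℕ)
variable (tb : ℕ → ℕ) (m2 : ℕ → List (ℕ × ℕ × ℕ)) (gain : ℕ → ℕ) (row : ℕ → Entry) (xrow : ℕ → List (ℕ × ℕ × ℕ))
variable (g p V d al tl M jtop : ℕ)

/-- The extra row facts: every member `q ≠ l` with `tq q ≤ TB[j+1] − 1`, `j ≤ jtop`, is dominated at every extra entry `x = (t′, gW′, wW′)` of bucket `j`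
(`Vq < t′·pq` and `gq·wW′ ≤ gW′·(t′·pq − Vq)`), and `wW′ ≥ 1`. [bookkeeping] -/
structure XHyps : Prop where
  domX : ∀ j ≤ jtop, ∀ x ∈ xrow j, ∀ q, q ≠ l → tq q ≤ tb (j + 1) - 1 →
    Vq q < x.1 * pq q ∧ gq q * x.2.2 ≤ x.2.1 * (x.1 * pq q - Vq q)
  denX : ∀ j ≤ jtop, ∀ x ∈ xrow j, 1 ≤ x.2.2

variable {l gq pq Vq mn tq ysh tb m2 gain row xrow g p V d al tl M jtop}

/-- **A passing extra test closes the estimate.** [original] -/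
theorem node_closeX_extra (H : Hyps l gq pq Vq mn tq ysh tb m2 gain row g p V d al tl M jtop) (HX : XHyps l gq pq Vq tq tb xrow jtop)
    {S : Finset (Fin N)} {A : Agg} {j : ℕ} {ms : List (ℕ × ℕ × ℕ)} (I : NodeInv l gq pq Vq mn tq ysh tb jtop S A j ms)
    {x : ℕ × ℕ × ℕ} (hx : x ∈ xrow j) (ht : testX g p V al tl A (tb j) M x = true) :
    g + ∑ q ∈ Finset.univ.erase l, gq q ≤ D * M := by
  classical
  have hout : ∀ q ∈ Finset.univ \ S, q ≠ l ∧ tq q ≤ tb (j + 1) - 1 := by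
    intro q hq
    rw [Finset.mem_sdiff] at hq
    exact ⟨fun h => hq.2 (h ▸ I.lmem), I.out q hq.2⟩
  have hGW : (∑ q ∈ Finset.univ \ S, gq q) * x.2.2 ≤ x.2.1 * ∑ q ∈ Finset.univ \ S, (x.1 * pq q - Vq q) := by
    rw [Finset.sum_mul, Finset.mul_sum]
    exact Finset.sum_le_sum fun q hq => (HX.domX j I.hj x hx q (hout q hq).1 (hout q hq).2).2
  have sg := sum_split (l := l) I.lmem gq
  have key := testX_sound ht (GR := ∑ q ∈ Finset.univ \ S, gq q) (W := ∑ q ∈ Finset.univ \ S, (x.1 * pq q - Vq q))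
    (HX.denX j I.hj x hx) hGW ?_
  · rw [sg, ← I.gO]; omega
  · -- the Grynkiewicz budget at t′ = x.1 from an explicit source, all weights genuine
    intro ht3 hVtp hamax hsrc
    set t := x.1 with htt
    have hsource : ∃ q, mn q < t ∧ t ≤ tq q := by
      rcases hsrc with ⟨hm, htb⟩ | ⟨hal, htl⟩
      · obtain ⟨q, hq, hlt⟩ := I.amin t (lt_of_le_of_lt htb (H.tbsmall j)) hm
        exact ⟨q, hlt, htb.trans (I.tmin q hq)⟩
      · exact ⟨l, by rw [H.al_eq]; exact hal, by rw [H.tl_eq]; exact htl⟩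
    have hbud := H.bud t ht3 hsource
    have hgen : ∀ q ∈ Finset.univ.erase l, Vq q ≤ t * pq q := by
      intro q hq
      by_cases hS : q ∈ S
      · exact H.Vgen q t ((I.amax q (Finset.mem_erase.mpr ⟨(Finset.mem_erase.mp hq).1, hS⟩)).trans hamax)
      · exact (HX.domX j I.hj x hx q (Finset.mem_erase.mp hq).1 (I.out q hS)).1.le
    have eW : (∑ q ∈ Finset.univ.erase l, (t * pq q - Vq q)) + ∑ q ∈ Finset.univ.erase l, Vq q =
        t * ∑ q ∈ Finset.univ.erase l, pq q := by
      rw [Finset.mul_sum, ← Finset.sum_add_distrib]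
      exact Finset.sum_congr rfl fun q hq => Nat.sub_add_cancel (hgen q hq)
    have eS : (∑ q ∈ S.erase l, (t * pq q - Vq q)) + ∑ q ∈ S.erase l, Vq q = t * ∑ q ∈ S.erase l, pq q := by
      rw [Finset.mul_sum, ← Finset.sum_add_distrib]
      exact Finset.sum_congr rfl fun q hq =>
        Nat.sub_add_cancel (hgen q (Finset.mem_erase.mpr ⟨(Finset.mem_erase.mp hq).1, Finset.mem_univ q⟩))
    have sw := sum_split (l := l) I.lmem (fun q => t * pq q - Vq q)
    have sv := sum_split (l := l) I.lmem Vq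
    have sp := sum_split (l := l) I.lmem pq
    rw [I.pO, I.vO]
    generalize hA1 : ∑ q ∈ Finset.univ.erase l, (t * pq q - Vq q) = A1 at eW sw
    generalize hA2 : ∑ q ∈ S.erase l, (t * pq q - Vq q) = A2 at eS sw
    generalize hA3 : ∑ q ∈ Finset.univ \ S, (t * pq q - Vq q) = A3 at sw ⊢
    generalize hP1 : ∑ q ∈ Finset.univ.erase l, pq q = P1 at eW hbud sp
    generalize hP2 : ∑ q ∈ S.erase l, pq q = P2 at eS sp
    generalize hV1 : ∑ q ∈ Finset.univ.erase l, Vq q = V1 at eW hbud sv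
    generalize hV2 : ∑ q ∈ S.erase l, Vq q = V2 at eS sv
    have e1 : t * (P1 + p) = t * P1 + t * p := by ring
    rw [e1] at hbud
    have e2 : t * P2 - V2 = A2 := by omega
    rw [e2]
    omega

/-- **A passing node test with extras closes the estimate.** [original] -/
theorem node_closeX (H : Hyps l gq pq Vq mn tq ysh tb m2 gain row g p V d al tl M jtop) (HX : XHyps l gq pq Vq tq tb xrow jtop)
    {S : Finset (Fin N)} {A : Agg} {j : ℕ} {ms : List (ℕ × ℕ × ℕ)} (I : NodeInv l gq pq Vq mn tq ysh tb jtop S A j ms) {root : Bool}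
    (hroot : root = true → 3 ≤ tb j → ∃ q, mn q < tb j ∧ tb j ≤ tq q)
    (ht : testKX g p V d al tl A (tb j) (tb j) M (row j) root (xrow j) = true) :
    g + ∑ q ∈ Finset.univ.erase l, gq q ≤ D * M := by
  rw [testKX, Bool.or_eq_true, List.any_eq_true] at ht
  rcases ht with ht | ⟨x, hx, htx⟩
  · exact node_close H I hroot ht
  · exact node_closeX_extra H HX I hx htx

/-- one unfolding step of the tree [bookkeeping] -/
theorem treeKX_succ (kmax n : ℕ) (A : Agg) (j : ℕ) (ms : List (ℕ × ℕ × ℕ)) :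
    treeKX tb m2 gain row xrow g p V d al tl M kmax (n + 1) A j ms =
      (testKX g p V d al tl A (tb j) (tb j) M (row j) false (xrow j) ||
        ((Nat.blt A.2.2.2.2.2 kmax && goI gain V (fun A' ms' => treeKX tb m2 gain row xrow g p V d al tl M kmax n A' j ms') A ms) &&
          match j with
          | 0 => false
          | j' + 1 => treeKX tb m2 gain row xrow g p V d al tl M kmax n A j' (m2 j'))) := rfl

/-- **Case (i) of a node** (as `goI_sound`, children = `treeKX` with fuel `n`, assumed sound). [original] -/
theorem goIX_sound (H : Hyps l gq pq Vq mn tq ysh tb m2 gain row g p V d al tl M jtop) {kmax n : ℕ}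
    (IH : ∀ (S : Finset (Fin N)) (A : Agg) (j : ℕ) (ms : List (ℕ × ℕ × ℕ)), NodeInv l gq pq Vq mn tq ysh tb jtop S A j ms →
      treeKX tb m2 gain row xrow g p V d al tl M kmax n A j ms = true → g + ∑ q ∈ Finset.univ.erase l, gq q ≤ D * M)
    {S : Finset (Fin N)} {A : Agg} {j : ℕ} {ms₀ : List (ℕ × ℕ × ℕ)} (I : NodeInv l gq pq Vq mn tq ysh tb jtop S A j ms₀)
    (hex : ∃ q, q ∉ S ∧ tb j ≤ tq q) :
    ∀ (ms' : List (ℕ × ℕ × ℕ)), (∀ q, q ∉ S → tb j ≤ tq q → ysh q ∈ ms') →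
      goI gain V (fun A' ms'' => treeKX tb m2 gain row xrow g p V d al tl M kmax n A' j ms'') A ms' = true →
      g + ∑ q ∈ Finset.univ.erase l, gq q ≤ D * M := by
  classical
  intro ms'
  induction ms' with
  | nil =>
    intro hall _
    obtain ⟨q, hq, hqt⟩ := hex
    exact absurd (hall q hq hqt) (by simp)
  | cons m rest ih =>
    intro hall hg
    have hunf' : goI gain V (fun A' ms'' => treeKX tb m2 gain row xrow g p V d al tl M kmax n A' j ms'') A (m :: rest) =
        ((Nat.blt V (vol m) || treeKX tb m2 gain row xrow g p V d al tl M kmax n (addM (gain (vol m)) A m) j (m :: rest)) &&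
          goI gain V (fun A' ms'' => treeKX tb m2 gain row xrow g p V d al tl M kmax n A' j ms'') A rest) := rfl
    rw [hunf', Bool.and_eq_true, Bool.or_eq_true, Nat.blt_eq] at hg
    obtain ⟨hfirst, hrest⟩ := hg
    by_cases hm : ∃ q, q ∉ S ∧ tb j ≤ tq q ∧ ysh q = m
    · obtain ⟨q₀, hq₀S, hq₀t, hq₀m⟩ := hm
      have hq₀l : q₀ ≠ l := fun h => hq₀S (h ▸ I.lmem)
      rcases hfirst with hbig | hchild
      · exfalso
        have := H.Vle q₀
        rw [← H.ysh_vol q₀, hq₀m] at this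
        omega
      have hSe : (insert q₀ S).erase l = insert q₀ (S.erase l) := by
        rw [Finset.erase_insert_of_ne hq₀l]
      have hq₀e : q₀ ∉ S.erase l := fun h => hq₀S (Finset.mem_of_mem_erase h)
      refine IH (insert q₀ S) (addM (gain (vol m)) A m) j (m :: rest) ⟨?_, I.hj, ?_, ?_, ?_, ?_, ?_, ?_, ?_, ?_⟩ hchild
      · exact Finset.mem_insert_of_mem I.lmem
      · simp only [addM]; rw [hSe, Finset.sum_insert hq₀e, I.gO, ← hq₀m, H.ysh_vol, H.gain_eq, Nat.add_comm]
      · simp only [addM]; rw [hSe, Finset.sum_insert hq₀e, I.pO, ← hq₀m, H.ysh_us, Nat.add_comm]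
      · simp only [addM]; rw [hSe, Finset.sum_insert hq₀e, I.vO, ← hq₀m, H.ysh_vol, Nat.add_comm]
      · intro t htb hlt
        simp only [addM] at hlt
        rcases lt_or_ge m.1 t with h1 | h1
        · exact ⟨q₀, by rw [hSe]; exact Finset.mem_insert_self _ _, by rw [← H.ysh_a, hq₀m]; exact h1⟩
        · have hlt' : A.2.2.2.1 < t := by
            by_contra hc; push Not at hc
            exact absurd hlt (not_lt.mpr (le_min hc h1))
          obtain ⟨q, hq, hq'⟩ := I.amin t htb hlt'
          exact ⟨q, by rw [hSe]; exact Finset.mem_insert_of_mem hq, hq'⟩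
      · intro q hq
        rw [hSe, Finset.mem_insert] at hq
        simp only [addM]
        rcases hq with rfl | hq
        · rw [← H.ysh_a, hq₀m]; exact le_max_right _ _
        · exact (I.amax q hq).trans (le_max_left _ _)
      · intro q hq
        rw [hSe, Finset.mem_insert] at hq
        rcases hq with rfl | hq
        · exact hq₀t
        · exact I.tmin q hq
      · intro q hq
        rw [Finset.mem_insert, not_or] at hq
        exact I.out q hq.2
      · intro q hq hqt
        rw [Finset.mem_insert, not_or] at hq
        exact hall q hq.2 hqt
    · push Not at hm
      refine ih (fun q hq hqt => ?_) hrest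
      have hin := hall q hq hqt
      rw [List.mem_cons] at hin
      rcases hin with heq | hin
      · exact absurd heq (hm q hq hqt)
      · exact hin

/-- **Soundness of the tree with extras** (induction over the fuel). [original] -/
theorem treeKX_sound (H : Hyps l gq pq Vq mn tq ysh tb m2 gain row g p V d al tl M jtop) (HX : XHyps l gq pq Vq tq tb xrow jtop) (kmax : ℕ) :
    ∀ (n : ℕ) (S : Finset (Fin N)) (A : Agg) (j : ℕ) (ms : List (ℕ × ℕ × ℕ)),
      NodeInv l gq pq Vq mn tq ysh tb jtop S A j ms → treeKX tb m2 gain row xrow g p V d al tl M kmax n A j ms = true →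
      g + ∑ q ∈ Finset.univ.erase l, gq q ≤ D * M
  | 0, S, A, j, ms, I, h => by simp [treeKX] at h
  | n + 1, S, A, j, ms, I, h => by
    classical
    rw [treeKX_succ, Bool.or_eq_true] at h
    rcases h with ht | h
    · exact node_closeX H HX I (fun hf => absurd hf Bool.false_ne_true) ht
    rw [Bool.and_eq_true, Bool.and_eq_true] at h
    obtain ⟨⟨-, hgo⟩, hdesc⟩ := h
    by_cases hex : ∃ q, q ∉ S ∧ tb j ≤ tq q
    · exact goIX_sound H (treeKX_sound H HX kmax n) I hex ms I.allowed hgo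
    · push Not at hex
      cases j with
      | zero => exact absurd hdesc Bool.false_ne_true
      | succ j' =>
        refine treeKX_sound H HX kmax n S A j' (m2 j') ⟨I.lmem, by have := I.hj; omega, I.gO, I.pO, I.vO, I.amin, I.amax, ?_, ?_, ?_⟩ hdesc
        · intro q hq; exact (H.tbmono j').trans (I.tmin q hq)
        · intro q hq
          have := hex q hq
          omega
        · intro q hq hqt
          have hql : q ≠ l := fun h => hq (h ▸ I.lmem)
          exact H.complete q hql j' (by have := I.hj; omega) hqt (by have := hex q hq; omega)

/-- **Soundness of the root with extras.**  At the bucket `j ≤ jtop` of `t*` (every member other than `l` has `t ≤ TB[j+1] − 1`; the member realising `t*`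
supplies the implicit source at the bucket parameter; if `j` lies strictly above `l`'s own bucket `j0`, that member is a companion in bucket `j`), a passing
`rootKX` gives `g + Σ_{q ≠ l} g_q ≤ 10⁶·M`. [original] -/
theorem rootKX_sound (H : Hyps l gq pq Vq mn tq ysh tb m2 gain row g p V d al tl M jtop) (HX : XHyps l gq pq Vq tq tb xrow jtop)
    {kmax j j0 : ℕ} (hj : j ≤ jtop)
    (hout : ∀ q, q ≠ l → tq q ≤ tb (j + 1) - 1)
    (hroot : 3 ≤ tb j → ∃ q, mn q < tb j ∧ tb j ≤ tq q)
    (habove : j0 < j → ∃ q, q ≠ l ∧ tb j ≤ tq q)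
    (h : rootKX tb m2 gain row xrow g p V d al tl M kmax j j0 = true) :
    g + ∑ q ∈ Finset.univ.erase l, gq q ≤ D * M := by
  classical
  have I : NodeInv l gq pq Vq mn tq ysh tb jtop {l} agg0 j (m2 j) :=
    nodeInv_root hj hout (m2 j) (fun q hq hqt => H.complete q hq j hj hqt (hout q hq))
  simp only [rootKX, Bool.or_eq_true, Bool.and_eq_true, Nat.blt_eq] at h
  rcases h with ht | ⟨hgo, hdesc⟩
  · exact node_closeX H HX I (fun _ h3 => hroot h3) ht
  by_cases hex : ∃ q, q ∉ ({l} : Finset (Fin N)) ∧ tb j ≤ tq q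
  · exact goIX_sound H (treeKX_sound H HX kmax (kmax + j + 1)) I hex (m2 j) I.allowed hgo
  · push Not at hex
    have hjj : ¬ j0 < j := by
      intro hlt
      obtain ⟨q, hq, hqt⟩ := habove hlt
      have := hex q (by simpa using hq)
      omega
    rcases hdesc with hlt | hdesc
    · exact absurd hlt hjj
    cases j with
    | zero => exact absurd hdesc Bool.false_ne_true
    | succ j' =>
      refine treeKX_sound H HX kmax (kmax + (j' + 1) + 1) {l} agg0 j' (m2 j') ⟨I.lmem, by omega, I.gO, I.pO, I.vO, I.amin, I.amax, ?_, ?_, ?_⟩ hdesc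
      · intro q hq; simp at hq
      · intro q hq
        have := hex q hq
        omega
      · intro q hq hqt
        have hql : q ≠ l := by simpa using hq
        exact H.complete q hql j' (by omega) hqt (by have := hex q hq; omega)

end Sound

end Summit.MatrixMultiplication.MatrixMultiplication.Theorems.TAStatKM
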